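import Summits.CriticalPhenomena.PercolationContinuityZ3.Theorems.SahiMasterFamilyTerminalPositive
import Summits.CriticalPhenomena.PercolationContinuityZ3.Theorems.SahiMasterFamilyPCDPositive

/-!
# (P3+) assembled: `SahiE3PositiveSomewhere` from ONE combinatorial statement (tightness at a common pivotal coordinate)

Unit `prim-masterthm-p4` (gen 11; crux anchor stmt-CriticalPhenomena-4575, helper work; memo
`run/shared/lean/prim/prim-masterthm/prim-masterthm-p4/FACE-QUOTIENT-3.md`).  Assembly of this generation's four files:

* `PositiveSomewhere.sahiE3PositiveOfTerminal_holds` — the terminal class of (P3+) is a THEOREM (`SahiMasterFamilyTerminalPositive`);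
* **`PositiveSomewhere.sahiE3PositiveSomewhere_of_commonPivotalFaceVanishing`** — (P3+) (`SahiE3PositiveSomewhere`: every triple of
  increasing events outside `Z_3` has `E_3(μ_p) > 0` at some interior `p`) follows from its common-pivotal face-vanishing class ALONE;
* **`PositiveSomewhere.sahiE3PositiveSomewhere_of_tight`** — hence from the purely combinatorial `FaceVanishingCommonPivotalTight`
  ("a face-vanishing triple with a common pivotal coordinate is tight"; census-exact on `{0,1}^{≤5}`);
* `suppZeroFlag_three_of_cored_coordinate_of_tight` — consequently gen 10's cored `r = 2` detector of the (EQI-4) endgame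
  (`suppZeroFlag_three_of_cored_coordinate_of_positiveSomewhere`) holds under that single combinatorial statement.
HONEST FRAMING: `FaceVanishingCommonPivotalTight`, (P3+), Sahi `C_k` / Kahn's Conjecture 5 and the master theorem remain OPEN. [this work]
-/

noncomputable section

open scoped Classical

namespace Summit.CriticalPhenomena.PercolationContinuityZ3.Theorems

open Finset Function
open Literature.Combinatorics.Sahi2008
open Literature.Probability.Percolation (DeterminedBy)
open Literature.Probability.Percolation.DecisionTree (ind)
open Literature.Probability.LatticeModels.Kahn2022 (Affects)

namespace PositiveSomewhere

/-- **The terminal class of (P3+) holds**: every terminal triple of increasing events has `E_3(μ_p) > 0` at some interior `p`. [this work] -/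
theorem sahiE3PositiveOfTerminal_holds : SahiE3PositiveOfTerminal :=
  fun _ _ U S hU hUS hT => exists_sahiE_three_pos_of_terminal U S hU hUS hT

/-- **(P3+) from its common-pivotal face-vanishing class alone.** [this work] -/
theorem sahiE3PositiveSomewhere_of_commonPivotalFaceVanishing (hV : SahiE3PositiveOfCommonPivotalFaceVanishing) :
    SahiE3PositiveSomewhere :=
  sahiE3PositiveSomewhere_of_terminal_of_commonPivotal sahiE3PositiveOfTerminal_holds hV

/-- **(P3+) from tightness at a common pivotal coordinate**: if every face-vanishing triple of increasing events with a common pivotal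
coordinate is tight (`FaceVanishingCommonPivotalTight`), then every triple of increasing events outside the zero-flag class `Z_3` has
`E_3(μ_p; 1_{U_0},1_{U_1},1_{U_2}) > 0` at some interior `p`. [this work] -/
theorem sahiE3PositiveSomewhere_of_tight (hT : FaceVanishingCommonPivotalTight) : SahiE3PositiveSomewhere :=
  sahiE3PositiveSomewhere_of_commonPivotalFaceVanishing (commonPivotalFaceVanishing_of_tight hT)

end PositiveSomewhere

/-- **The cored `r_e = 2` detector under the tightness statement** (gen 10's `suppZeroFlag_three_of_cored_coordinate_of_positiveSomewhere`
with (P3+) discharged down to `FaceVanishingCommonPivotalTight`): four increasing events with `E_4(μ_p; 1_U) = 0` at every interior `p`; the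
coordinate `e` acts on `U_0`, lies in the core of `U_1` and does not act on `U_2, U_3`; then `(U_1, U_2, U_3)` is a zero flag. [this work] -/
theorem suppZeroFlag_three_of_cored_coordinate_of_tight {ι : Type} [Fintype ι]
    (hT : PositiveSomewhere.FaceVanishingCommonPivotalTight) (e : ι)
    (U : Fin 4 → Set (Set ι)) (hU : ∀ j, IsUpperSet (U j)) (he₀ : Affects (U 0) e) (hcore : secAt e false (U 1) = ∅)
    (he₂ : ¬ Affects (U 2) e) (he₃ : ¬ Affects (U 3) e)
    (h : ∀ p : ι → unitInterval, (∀ i, (p i : ℝ) ∈ Set.Ioo (0 : ℝ) 1) →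
      sahiE (bernoulliWeight p) 4 (fun j => ind (U j)) = 0) :
    SuppZeroFlag 3 ![U 1, U 2, U 3] :=
  suppZeroFlag_three_of_cored_coordinate_of_positiveSomewhere (PositiveSomewhere.sahiE3PositiveSomewhere_of_tight hT) e U hU he₀
    hcore he₂ he₃ h

end Summit.CriticalPhenomena.PercolationContinuityZ3.Theorems
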